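import Summits.BirchSwinnertonDyer.BirchSwinnertonDyer.Theorems.Rank1ResidualPartitionBinding
import Summits.BirchSwinnertonDyer.Rank1Residual.X9.SurjBigImage

set_option linter.dupNamespace false
set_option autoImplicit false

/-!
# Rank-≤ 1 residual PARTITION, part 3/3 — the partition theorems

`partition (hr : r_an ≤ 1) (hSerre) : COVERED ∨ (ClassX1 ∨ … ∨ ClassX12) ∨ FORMER-C4`, all three
disjuncts explicit (no `Prop` constant is defined): COVERED = one conjunction per covering row of
RESIDUAL-CASES §a.1 (its citation in a comment before each), the classes verbatim from
`Predicates.lean`, and — **SAID LOUDLY** — the one live region in NO covering row and NO Lean class: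
`r = 1 ∧ Mult p ∧ Irr p ∧ Semistable ∧ Ram p ∧ 5 ≤ p`, the domain of the WITHDRAWN row C4
(Castella 2018 Thm A, author's erratum; `Castella2018/MultiplicativePPartErratum.lean`), which
RESIDUAL-CASES §a.2 files under X11b (v6, G33) while the tree's `ClassX11` (v3 transcription
`Mult ∧ Irr ∧ (¬Ram ∨ (r = 1 ∧ ¬sst) ∨ (r = 1 ∧ p = 3))`) excludes it — so "no NEW cell" is false
for the classes as typed, by exactly this region (`classify_eq_newFormerC4_iff`, part 1), and true
for the census rows. Recommendation to the typers (nothing is re-typed here): `ClassX11' :=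
Mult ∧ Irr ∧ (¬Ram ∨ r = 1)`.
**Serre.** 48 grid cells (`surj(p) ∧ p ≥ 5 ∧ ¬(im)`, non-CM ordinary irreducible) are empty only by
Serre's open-image lemma (surjective `ρ̄_{E,p}`, `p ≥ 5` ⇒ `ρ_{E,p^∞} ⊇ SL₂(ℤ_p)` ⇒ (im); Serre
1968 IV-23, 1972), which the census uses (§a.0) but no tree declaration states; it is NOT minted
here: `partition` carries `hSerre : 5 ≤ p → Surj W p → BigIm W p`, and `partition_or_serre` is the
hypothesis-free form with the Serre configuration as a fourth disjunct; since the x9 seat landed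
`Summit.BirchSwinnertonDyer.Rank1Residual.X9.bigIm_of_surj` (p200544: `5 ≤ p → Surj W p → BigIm W p`),
`partition_unconditional (hr : r_an ≤ 1)` discharges `hSerre` by that tree theorem — the HEADLINE OF RECORD
of this formalization, with no input beyond the tree.
`partition_cm`: a CM pair is covered by C8 / C17 / C9 / C10 or lies in X12 — CM is decided before
every supersingular test (acceptance point 7). The budget line `U` of the census (uncertified
Heegner index) has no coordinate: every pair of a `U` curve has a cell like any other (point 4).
Links `bsdp_of_classify_eq_C2 / C16 / C7 / C6`: cells of those rows ⇒ `BSDp W p` by the tree's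
assembled theorems and the named published facts they consume (C6 additionally needs the paper's
torsion bit `p ∤ #E(ℚ)_tors`). Engines, counts, flags, acceptance test: HOME/PARTITION.md.
-/

noncomputable section

open scoped Classical

open WeierstrassCurve Literature.NumberTheory.EllipticCurves
  Literature.NumberTheory.EllipticCurves.ModularForms Literature.NumberTheory.EllipticCurves.Rank1Residual

namespace Summit.BirchSwinnertonDyer.BirchSwinnertonDyer.Rank1Residual.Partition

variable (W : WeierstrassCurve ℚ) [W.IsElliptic] [W.IsGloballyMinimal] (p : ℕ) [Fact p.Prime]

/-- **PARTITION (headline).** For every elliptic curve `E/ℚ` of analytic rank `≤ 1` (globally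
minimal model `W`) and every prime `p`: EITHER the printed hypotheses of a cited covering theorem
of RESIDUAL-CASES §a.1 hold at `(E, p)` (first disjunct, one conjunction per row), OR `(E, p)`
lies in one of the residual classes X1–X12 of `Predicates.lean` (second disjunct), OR it lies in
the former C4 domain (third disjunct; filed under X11b by RESIDUAL-CASES §a.2 but outside the
Lean `ClassX11` — said loudly). The only
input beyond the tree is Serre's open-image lemma `hSerre` (surj(p) ∧ p ≥ 5 ⇒ (im)), used by the
census itself (§a.0) and awaiting a `Literature/` vendoring. Nothing about BSD is claimed. -/
theorem partition (hr : W.analyticRank ≤ 1) (hSerre : 5 ≤ p → Surj W p → BigIm W p) :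
    ( -- COVERED: the printed hypotheses of a cited class-level covering row of RESIDUAL-CASES §a.1
      -- C1: Skinner 2016 Thm C / Skinner–Urban 2014 Thm 2(a)
      (W.analyticRank = 0 ∧ 3 ≤ p ∧ (GoodOrd W p ∨ Mult W p) ∧ Irr W p ∧ Ram W p)
      -- C2: Burungale–Castella–Skinner 2025 Cor. 1.3.1
      ∨ (¬ W.HasCM ∧ 3 < p ∧ GoodOrd W p ∧ Irr W p ∧ BigIm W p ∧ W.analyticRank ≤ 1)
      -- C3: Jetchev–Skinner–Wan 2017 Thm 1.2.1
      ∨ (W.analyticRank = 1 ∧ Semistable W ∧ Good W p ∧ Irr W p ∧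
          (5 ≤ p ∨ (p = 3 ∧ (GoodOrd W p ∨ W.frobeniusTrace 3 = 0))))
      -- C6: Castella–Grossi–Skinner 2025 Thm 4 (= Thm D)
      ∨ (2 < p ∧ Red W p ∧ Good W p ∧ ¬ Anom W p ∧ W.analyticRank ≤ 1)
      -- C7: Greenberg–Vatsal 2000 Thm 1.3 + Kato + Greenberg 1999 Thm 4.1
      ∨ (W.analyticRank = 0 ∧ ¬ W.HasCM ∧ p ≠ 2 ∧ GoodOrd W p ∧ Red W p ∧ GVPar W p)
      -- C8: Burungale–Flach 2024 Cor. 2 (+ Rubin 1991 Thm 11.1)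
      ∨ (W.HasCM ∧ W.analyticRank = 0)
      -- C9: Rubin 1991 (Miller 2011 Thm 3.1(iii))
      ∨ (W.HasCM ∧ W.analyticRank = 1 ∧ p ≠ 2 ∧ CMSplit W p ∧ Good W p)
      -- C10: Kobayashi 2013 Cor. 1.4
      ∨ (W.HasCM ∧ W.analyticRank = 1 ∧ p ≠ 2 ∧ CMInert W p ∧ Good W p)
      -- C16: Yan–Zhu 2026 Thm 4.15 (§4.6), (Im) form
      ∨ (¬ W.HasCM ∧ 3 ≤ p ∧ GoodOrd W p ∧ Irr W p ∧ BigIm W p ∧ W.analyticRank ≤ 1)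
      -- C17: Li–Liu–Tian 2024 Thm 1.1(i)
      ∨ (W.HasCM ∧ W.analyticRank = 1 ∧ p ≠ 2 ∧ CMSplit W p))
    ∨ ( -- RESIDUAL: the twelve classes of `Predicates.lean`, verbatim
      ClassX1 W p ∨ ClassX2 W p ∨ ClassX3 W p ∨ ClassX4 W p ∨ ClassX5 W p ∨ ClassX6 W p ∨
      ClassX7 W p ∨ ClassX8 W p ∨ ClassX9 W p ∨ ClassX10 W p ∨ ClassX11 W p ∨ ClassX12 W p)
    ∨ ( -- the FORMER C4 DOMAIN (Castella 2018 Thm A, withdrawn at p ∥ N): in no row, in no class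
      W.analyticRank = 1 ∧ Mult W p ∧ Irr W p ∧ Semistable W ∧ Ram W p ∧ 5 ≤ p) := by
  have h := holds_of_spec (W := W) (p := p) hr _ (spec_classify (cellOf W p))
  generalize classify (cellOf W p) = t at h
  cases t
  · -- emptyAnom
    exact False.elim h
  · -- emptySstAdd
    exact False.elim h
  · -- emptySurjRed
    exact False.elim h
  · -- emptySmallIm
    exact False.elim h
  · -- emptySsRed
    exact False.elim h
  · -- emptySstIrrNonsurj
    exact False.elim h
  · -- C8
    exact Or.inl (Or.inr (Or.inr (Or.inr (Or.inr (Or.inr (Or.inl h))))))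
  · -- C17
    exact Or.inl (Or.inr (Or.inr (Or.inr (Or.inr (Or.inr (Or.inr (Or.inr (Or.inr (Or.inr (h))))))))))
  · -- C9
    exact Or.inl (Or.inr (Or.inr (Or.inr (Or.inr (Or.inr (Or.inr (Or.inl h)))))))
  · -- C10
    exact Or.inl (Or.inr (Or.inr (Or.inr (Or.inr (Or.inr (Or.inr (Or.inr (Or.inl h))))))))
  · -- X12
    exact Or.inr (Or.inl (Or.inr (Or.inr (Or.inr (Or.inr (Or.inr (Or.inr (Or.inr (Or.inr (Or.inr (Or.inr (Or.inr (h)))))))))))))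
  · -- X5
    exact Or.inr (Or.inl (Or.inr (Or.inr (Or.inr (Or.inr (Or.inl h))))))
  · -- C1
    exact Or.inl (Or.inl h)
  · -- C2
    exact Or.inl (Or.inr (Or.inl h))
  · -- C16
    exact Or.inl (Or.inr (Or.inr (Or.inr (Or.inr (Or.inr (Or.inr (Or.inr (Or.inr (Or.inl h)))))))))
  · -- C3
    exact Or.inl (Or.inr (Or.inr (Or.inl h)))
  · -- C6
    exact Or.inl (Or.inr (Or.inr (Or.inr (Or.inl h))))
  · -- C7
    exact Or.inl (Or.inr (Or.inr (Or.inr (Or.inr (Or.inl h)))))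
  · -- X3
    exact Or.inr (Or.inl (Or.inr (Or.inr (Or.inl h))))
  · -- X4
    exact Or.inr (Or.inl (Or.inr (Or.inr (Or.inr (Or.inl h)))))
  · -- X2
    exact Or.inr (Or.inl (Or.inr (Or.inl h)))
  · -- X1
    exact Or.inr (Or.inl (Or.inl h))
  · -- X8
    exact Or.inr (Or.inl (Or.inr (Or.inr (Or.inr (Or.inr (Or.inr (Or.inr (Or.inr (Or.inl h)))))))))
  · -- X7
    exact Or.inr (Or.inl (Or.inr (Or.inr (Or.inr (Or.inr (Or.inr (Or.inr (Or.inl h))))))))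
  · -- X6
    exact Or.inr (Or.inl (Or.inr (Or.inr (Or.inr (Or.inr (Or.inr (Or.inl h)))))))
  · -- X9
    exact Or.inr (Or.inl (Or.inr (Or.inr (Or.inr (Or.inr (Or.inr (Or.inr (Or.inr (Or.inr (Or.inl h))))))))))
  · -- X10
    exact Or.inr (Or.inl (Or.inr (Or.inr (Or.inr (Or.inr (Or.inr (Or.inr (Or.inr (Or.inr (Or.inr (Or.inl h)))))))))))
  · -- X11
    exact Or.inr (Or.inl (Or.inr (Or.inr (Or.inr (Or.inr (Or.inr (Or.inr (Or.inr (Or.inr (Or.inr (Or.inr (Or.inl h))))))))))))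
  · -- newFormerC4
    exact Or.inr (Or.inr h)
  · -- emptyLitSerre
    dsimp only at h
    exact absurd (hSerre h.1 h.2.1) h.2.2
  · -- gap
    exact False.elim h

/-- The same WITHOUT the Serre input: the conclusion holds up to the one explicit Serre
configuration `p ≥ 5 ∧ surj(p) ∧ ¬(im)` (empty by Serre 1968/1972, not yet in the tree). -/
theorem partition_or_serre (hr : W.analyticRank ≤ 1) :
    ( -- COVERED (as in `partition`)
      -- C1: Skinner 2016 Thm C / Skinner–Urban 2014 Thm 2(a)
      (W.analyticRank = 0 ∧ 3 ≤ p ∧ (GoodOrd W p ∨ Mult W p) ∧ Irr W p ∧ Ram W p)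
      -- C2: Burungale–Castella–Skinner 2025 Cor. 1.3.1
      ∨ (¬ W.HasCM ∧ 3 < p ∧ GoodOrd W p ∧ Irr W p ∧ BigIm W p ∧ W.analyticRank ≤ 1)
      -- C3: Jetchev–Skinner–Wan 2017 Thm 1.2.1
      ∨ (W.analyticRank = 1 ∧ Semistable W ∧ Good W p ∧ Irr W p ∧
          (5 ≤ p ∨ (p = 3 ∧ (GoodOrd W p ∨ W.frobeniusTrace 3 = 0))))
      -- C6: Castella–Grossi–Skinner 2025 Thm 4 (= Thm D)
      ∨ (2 < p ∧ Red W p ∧ Good W p ∧ ¬ Anom W p ∧ W.analyticRank ≤ 1)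
      -- C7: Greenberg–Vatsal 2000 Thm 1.3 + Kato + Greenberg 1999 Thm 4.1
      ∨ (W.analyticRank = 0 ∧ ¬ W.HasCM ∧ p ≠ 2 ∧ GoodOrd W p ∧ Red W p ∧ GVPar W p)
      -- C8: Burungale–Flach 2024 Cor. 2 (+ Rubin 1991 Thm 11.1)
      ∨ (W.HasCM ∧ W.analyticRank = 0)
      -- C9: Rubin 1991 (Miller 2011 Thm 3.1(iii))
      ∨ (W.HasCM ∧ W.analyticRank = 1 ∧ p ≠ 2 ∧ CMSplit W p ∧ Good W p)
      -- C10: Kobayashi 2013 Cor. 1.4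
      ∨ (W.HasCM ∧ W.analyticRank = 1 ∧ p ≠ 2 ∧ CMInert W p ∧ Good W p)
      -- C16: Yan–Zhu 2026 Thm 4.15 (§4.6), (Im) form
      ∨ (¬ W.HasCM ∧ 3 ≤ p ∧ GoodOrd W p ∧ Irr W p ∧ BigIm W p ∧ W.analyticRank ≤ 1)
      -- C17: Li–Liu–Tian 2024 Thm 1.1(i)
      ∨ (W.HasCM ∧ W.analyticRank = 1 ∧ p ≠ 2 ∧ CMSplit W p))
    ∨ ( -- RESIDUAL
      ClassX1 W p ∨ ClassX2 W p ∨ ClassX3 W p ∨ ClassX4 W p ∨ ClassX5 W p ∨ ClassX6 W p ∨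
      ClassX7 W p ∨ ClassX8 W p ∨ ClassX9 W p ∨ ClassX10 W p ∨ ClassX11 W p ∨ ClassX12 W p)
    ∨ ( -- FORMER C4 DOMAIN
      W.analyticRank = 1 ∧ Mult W p ∧ Irr W p ∧ Semistable W ∧ Ram W p ∧ 5 ≤ p)
    ∨ ( -- the SERRE CONFIGURATION (empty by Serre 1968/1972, not yet a tree theorem)
      5 ≤ p ∧ Surj W p ∧ ¬ BigIm W p) := by
  by_cases hS : 5 ≤ p → Surj W p → BigIm W p
  · rcases partition W p hr hS with h | h | h
    · exact Or.inl h
    · exact Or.inr (Or.inl h)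
    · exact Or.inr (Or.inr (Or.inl h))
  · push Not at hS
    exact Or.inr (Or.inr (Or.inr ⟨hS.1, hS.2.1, hS.2.2⟩))

/-- **CM pairs never reach the non-CM classes** (acceptance point 7, real-curve form): for a CM
curve of analytic rank `≤ 1`, `(E, p)` is Covered (C8 / C9 / C10 / C17) or in X12 — in particular
never in X5 / X6 / X7 / X8. No Serre input needed. -/
theorem partition_cm (hr : W.analyticRank ≤ 1) (hcm : W.HasCM) :
    ( -- COVERED (as in `partition`; only C8 / C9 / C10 / C17 can fire)
      -- C1: Skinner 2016 Thm C / Skinner–Urban 2014 Thm 2(a)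
      (W.analyticRank = 0 ∧ 3 ≤ p ∧ (GoodOrd W p ∨ Mult W p) ∧ Irr W p ∧ Ram W p)
      -- C2: Burungale–Castella–Skinner 2025 Cor. 1.3.1
      ∨ (¬ W.HasCM ∧ 3 < p ∧ GoodOrd W p ∧ Irr W p ∧ BigIm W p ∧ W.analyticRank ≤ 1)
      -- C3: Jetchev–Skinner–Wan 2017 Thm 1.2.1
      ∨ (W.analyticRank = 1 ∧ Semistable W ∧ Good W p ∧ Irr W p ∧
          (5 ≤ p ∨ (p = 3 ∧ (GoodOrd W p ∨ W.frobeniusTrace 3 = 0))))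
      -- C6: Castella–Grossi–Skinner 2025 Thm 4 (= Thm D)
      ∨ (2 < p ∧ Red W p ∧ Good W p ∧ ¬ Anom W p ∧ W.analyticRank ≤ 1)
      -- C7: Greenberg–Vatsal 2000 Thm 1.3 + Kato + Greenberg 1999 Thm 4.1
      ∨ (W.analyticRank = 0 ∧ ¬ W.HasCM ∧ p ≠ 2 ∧ GoodOrd W p ∧ Red W p ∧ GVPar W p)
      -- C8: Burungale–Flach 2024 Cor. 2 (+ Rubin 1991 Thm 11.1)
      ∨ (W.HasCM ∧ W.analyticRank = 0)
      -- C9: Rubin 1991 (Miller 2011 Thm 3.1(iii))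
      ∨ (W.HasCM ∧ W.analyticRank = 1 ∧ p ≠ 2 ∧ CMSplit W p ∧ Good W p)
      -- C10: Kobayashi 2013 Cor. 1.4
      ∨ (W.HasCM ∧ W.analyticRank = 1 ∧ p ≠ 2 ∧ CMInert W p ∧ Good W p)
      -- C16: Yan–Zhu 2026 Thm 4.15 (§4.6), (Im) form
      ∨ (¬ W.HasCM ∧ 3 ≤ p ∧ GoodOrd W p ∧ Irr W p ∧ BigIm W p ∧ W.analyticRank ≤ 1)
      -- C17: Li–Liu–Tian 2024 Thm 1.1(i)
      ∨ (W.HasCM ∧ W.analyticRank = 1 ∧ p ≠ 2 ∧ CMSplit W p))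
    ∨ ClassX12 W p := by
  have hc : (cellOf W p).cm = true := by simpa [cellOf] using hcm
  have h := holds_of_spec (W := W) (p := p) hr _ (spec_classify (cellOf W p))
  have ha := classify_cm (cellOf W p) hc
  generalize classify (cellOf W p) = t at h ha
  cases t
  · -- emptyAnom
    exact False.elim h
  · -- emptySstAdd
    exact False.elim h
  · -- emptySurjRed
    exact False.elim h
  · -- emptySmallIm
    exact False.elim h
  · -- emptySsRed
    exact False.elim h
  · -- emptySstIrrNonsurj
    exact False.elim h
  · -- C8
    exact Or.inl (Or.inr (Or.inr (Or.inr (Or.inr (Or.inr (Or.inl h))))))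
  · -- C17
    exact Or.inl (Or.inr (Or.inr (Or.inr (Or.inr (Or.inr (Or.inr (Or.inr (Or.inr (Or.inr (h))))))))))
  · -- C9
    exact Or.inl (Or.inr (Or.inr (Or.inr (Or.inr (Or.inr (Or.inr (Or.inl h)))))))
  · -- C10
    exact Or.inl (Or.inr (Or.inr (Or.inr (Or.inr (Or.inr (Or.inr (Or.inr (Or.inl h))))))))
  · -- X12
    exact Or.inr h
  · -- X5: not reachable by a CM cell
    simp [Target.cmAllowed] at ha
  · -- C1: not reachable by a CM cell
    simp [Target.cmAllowed] at ha
  · -- C2: not reachable by a CM cell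
    simp [Target.cmAllowed] at ha
  · -- C16: not reachable by a CM cell
    simp [Target.cmAllowed] at ha
  · -- C3: not reachable by a CM cell
    simp [Target.cmAllowed] at ha
  · -- C6: not reachable by a CM cell
    simp [Target.cmAllowed] at ha
  · -- C7: not reachable by a CM cell
    simp [Target.cmAllowed] at ha
  · -- X3: not reachable by a CM cell
    simp [Target.cmAllowed] at ha
  · -- X4: not reachable by a CM cell
    simp [Target.cmAllowed] at ha
  · -- X2: not reachable by a CM cell
    simp [Target.cmAllowed] at ha
  · -- X1: not reachable by a CM cell
    simp [Target.cmAllowed] at ha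
  · -- X8: not reachable by a CM cell
    simp [Target.cmAllowed] at ha
  · -- X7: not reachable by a CM cell
    simp [Target.cmAllowed] at ha
  · -- X6: not reachable by a CM cell
    simp [Target.cmAllowed] at ha
  · -- X9: not reachable by a CM cell
    simp [Target.cmAllowed] at ha
  · -- X10: not reachable by a CM cell
    simp [Target.cmAllowed] at ha
  · -- X11: not reachable by a CM cell
    simp [Target.cmAllowed] at ha
  · -- newFormerC4: not reachable by a CM cell
    simp [Target.cmAllowed] at ha
  · -- emptyLitSerre: not reachable by a CM cell
    simp [Target.cmAllowed] at ha
  · -- gap: not reachable by a CM cell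
    simp [Target.cmAllowed] at ha

/-! ### Links: cells of rows C2, C16, C7, C6 ⇒ `BSD(E,p)` by the tree's assembled theorems
(the row's hypotheses + the named PUBLISHED facts those theorems consume; for C6 also the paper's
per-pair torsion bit `p ∤ #E(ℚ)_tors`, a hypothesis of Castella–Grossi–Skinner's Theorem D that is
not a grid atom). The other rows' theorems are cited (RESIDUAL-CASES §a.1), not yet assembled to
`BSDp` in the tree; nothing is claimed for them here. -/

variable {W p}

/-- Cell in row C2 ⇒ `BSD(E,p)` via `BurungaleCastellaSkinner2025.bsdp_of_cor131`. -/
theorem bsdp_of_classify_eq_C2 (hr : W.analyticRank ≤ 1) (hc : classify (cellOf W p) = .C2)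
    (h : BurungaleCastellaSkinner2025.cor131_padicValRat_bsd_rank_le_one)
    (hGZK : rank_eq_analyticRank_of_analyticRank_le_one) : BSDp W p := by
  have hs := spec_classify (cellOf W p)
  rw [hc] at hs
  obtain ⟨h1, h2, h3, h4, h5, h6⟩ := holds_of_spec (W := W) (p := p) hr .C2 hs
  exact BurungaleCastellaSkinner2025.bsdp_of_cor131 h hGZK W p h1 h2 h3 h4 h5 h6

/-- Cell in row C16 ⇒ `BSD(E,p)` via `Rank1Residual.bsdp_of_goodOrd_irr_bigIm`. -/
theorem bsdp_of_classify_eq_C16 (hr : W.analyticRank ≤ 1) (hc : classify (cellOf W p) = .C16)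
    (hYZ : YanZhu2026.thm415_padicValRat_bsd_rank_le_one_of_bigIm)
    (hGZK : rank_eq_analyticRank_of_analyticRank_le_one) (hmod : hasEntireLFunction_rat) :
    BSDp W p := by
  have hs := spec_classify (cellOf W p)
  rw [hc] at hs
  obtain ⟨-, h2, h3, h4, h5, h6⟩ := holds_of_spec (W := W) (p := p) hr .C16 hs
  exact bsdp_of_goodOrd_irr_bigIm (W := W) hYZ hGZK hmod p h2 h3 h4 h5 h6

/-- Cell in row C7 ⇒ `BSD(E,p)` via `Rank1Residual.bsdp_of_gvPar_of_analyticRank_eq_zero`. -/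
theorem bsdp_of_classify_eq_C7 (hr : W.analyticRank ≤ 1) (hc : classify (cellOf W p) = .C7)
    (hGV : GreenbergVatsal2000.thm13_charIdeal_eq_of_gvPar) (hGr : greenberg_charValue_rankZero)
    (hmod : hasEntireLFunction_rat) (hmodP : nonempty_modularParametrizationData)
    (hGZK : rank_eq_analyticRank_of_analyticRank_le_one) : BSDp W p := by
  have hs := spec_classify (cellOf W p)
  rw [hc] at hs
  obtain ⟨h1, -, h3, h4, -, h6⟩ := holds_of_spec (W := W) (p := p) hr .C7 hs
  exact bsdp_of_gvPar_of_analyticRank_eq_zero hGV hGr hmod hmodP hGZK W p h3 h4 h6 h1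

/-- Cell in row C6 ⇒ `BSD(E,p)` via `CastellaGrossiSkinner2025.bsdp_of_thmD`, given the per-pair
torsion bit `p ∤ #E(ℚ)_tors` of Theorem D. -/
theorem bsdp_of_classify_eq_C6 (hr : W.analyticRank ≤ 1) (hc : classify (cellOf W p) = .C6)
    (hD : CastellaGrossiSkinner2025.thmD_padicValRat_bsd_rank_le_one)
    (hmod : hasEntireLFunction_rat) (hGZK : rank_eq_analyticRank_of_analyticRank_le_one)
    (htors : ¬ p ∣ W.torsionOrder) : BSDp W p := by
  have hs := spec_classify (cellOf W p)
  rw [hc] at hs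
  obtain ⟨h1, h2, h3, h4, h5⟩ := holds_of_spec (W := W) (p := p) hr .C6 hs
  exact CastellaGrossiSkinner2025.bsdp_of_thmD hD hmod hGZK W p h1 h3 h2 h4 h5 htors


/-- **PARTITION, hypothesis-free (headline of record for this formalization).** `partition` with
Serre's open-image input DISCHARGED by the tree theorem
`Summit.BirchSwinnertonDyer.Rank1Residual.X9.bigIm_of_surj` (x9 seat, p200544: `5 ≤ p → Surj W p →
BigIm W p`; Serre 1968 IV-23 Lemma 3 + compactness of `Γ_ℚ` + the Weil pairing): for EVERY elliptic
curve over `ℚ` of analytic rank `≤ 1` and EVERY prime, the pair lies in a cited covering row, or in one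
of the residual classes X1–X12 of `Predicates.lean` verbatim, or in the former-C4 configuration — with
no input beyond the tree. Nothing about BSD is claimed. -/
theorem partition_unconditional (hr : W.analyticRank ≤ 1) :
    ( -- COVERED: the printed hypotheses of a cited class-level covering row of RESIDUAL-CASES §a.1
      -- C1: Skinner 2016 Thm C / Skinner–Urban 2014 Thm 2(a)
      (W.analyticRank = 0 ∧ 3 ≤ p ∧ (GoodOrd W p ∨ Mult W p) ∧ Irr W p ∧ Ram W p)
      -- C2: Burungale–Castella–Skinner 2025 Cor. 1.3.1
      ∨ (¬ W.HasCM ∧ 3 < p ∧ GoodOrd W p ∧ Irr W p ∧ BigIm W p ∧ W.analyticRank ≤ 1)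
      -- C3: Jetchev–Skinner–Wan 2017 Thm 1.2.1
      ∨ (W.analyticRank = 1 ∧ Semistable W ∧ Good W p ∧ Irr W p ∧
          (5 ≤ p ∨ (p = 3 ∧ (GoodOrd W p ∨ W.frobeniusTrace 3 = 0))))
      -- C6: Castella–Grossi–Skinner 2025 Thm 4 (= Thm D)
      ∨ (2 < p ∧ Red W p ∧ Good W p ∧ ¬ Anom W p ∧ W.analyticRank ≤ 1)
      -- C7: Greenberg–Vatsal 2000 Thm 1.3 + Kato + Greenberg 1999 Thm 4.1
      ∨ (W.analyticRank = 0 ∧ ¬ W.HasCM ∧ p ≠ 2 ∧ GoodOrd W p ∧ Red W p ∧ GVPar W p)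
      -- C8: Burungale–Flach 2024 Cor. 2 (+ Rubin 1991 Thm 11.1)
      ∨ (W.HasCM ∧ W.analyticRank = 0)
      -- C9: Rubin 1991 (Miller 2011 Thm 3.1(iii))
      ∨ (W.HasCM ∧ W.analyticRank = 1 ∧ p ≠ 2 ∧ CMSplit W p ∧ Good W p)
      -- C10: Kobayashi 2013 Cor. 1.4
      ∨ (W.HasCM ∧ W.analyticRank = 1 ∧ p ≠ 2 ∧ CMInert W p ∧ Good W p)
      -- C16: Yan–Zhu 2026 Thm 4.15 (§4.6), (Im) form
      ∨ (¬ W.HasCM ∧ 3 ≤ p ∧ GoodOrd W p ∧ Irr W p ∧ BigIm W p ∧ W.analyticRank ≤ 1)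
      -- C17: Li–Liu–Tian 2024 Thm 1.1(i)
      ∨ (W.HasCM ∧ W.analyticRank = 1 ∧ p ≠ 2 ∧ CMSplit W p))
    ∨ ( -- RESIDUAL: the twelve classes of `Predicates.lean`, verbatim
      ClassX1 W p ∨ ClassX2 W p ∨ ClassX3 W p ∨ ClassX4 W p ∨ ClassX5 W p ∨ ClassX6 W p ∨
      ClassX7 W p ∨ ClassX8 W p ∨ ClassX9 W p ∨ ClassX10 W p ∨ ClassX11 W p ∨ ClassX12 W p)
    ∨ ( -- the FORMER C4 DOMAIN (Castella 2018 Thm A, withdrawn at p ∥ N): in no row, in no class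
      W.analyticRank = 1 ∧ Mult W p ∧ Irr W p ∧ Semistable W ∧ Ram W p ∧ 5 ≤ p) :=
  partition W p hr (fun h5 hs => Summit.BirchSwinnertonDyer.Rank1Residual.X9.bigIm_of_surj W p h5 hs)

end Summit.BirchSwinnertonDyer.BirchSwinnertonDyer.Rank1Residual.Partition

end
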